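import Summits.QuantumAdvantage.QuantumAdvantage.Theses.CubicForrelation
import Summits.QuantumAdvantage.QuantumAdvantage.Theorems.CubicForrelationExactPairsMaioranaMcFarlandDillonNormalForm
import Literature.Computability.QuantumComplexity.ForrelationDirectSum
import Literature.Computability.AlgebraicComplexity.PowerSumNonvanishing

/-!
# Crux `CubicForrelation.NearExactIsExact` (stmt-QuantumAdvantage-14043) — stub `stub_mmNormalForm`

Line `direct-sum-amplification`, stub N (KNOWN branch): the Maiorana–McFarland NORMAL FORM of a cubic `g` on
`m + m` bits carrying an M-subspace `V` (`0 ∈ V`, xor-closed, `|V|² = 2^{m+m}`, all second differences of `g` along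
`V` vanish), Dillon/McFarland straightening [J. F. Dillon, PhD thesis, Univ. of Maryland (1974); C. Carlet,
*Boolean Functions for Cryptography and Coding Theory* (CUP 2021), Prop. 54].

Statement.  There are `f₁ g₁` on `m + m` bits, `π : 𝔽₂^m → 𝔽₂^m` coordinatewise QUADRATIC and `h` CUBIC with
`f₁` cubic, `(-1)^{g₁(y₁ ‖ y₂)} = (-1)^{⟨y₁, π y₂⟩} (-1)^{h y₂}` and `Φ(f₁, g₁) = Φ(f, g)`.  No bijectivity of `π`.

Proof.  Read Bool-vectors in `ZMod 2` along `ind` (the dictionary `dnf_*` of the tree file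
`…ExactPairsMaioranaMcFarlandDillonNormalForm`).  `V` is an `m`-dimensional subspace `S` (`dnf_exists_submodule`,
`dnf_finrank_eq`), straightened by a linear automorphism `Φ(a ‖ b) = w(b) + Σ_i a_i v_i`, `v_i ∈ S`
(`dnf_exists_linearEquiv`); vanishing second differences make `g` affine along `S` (`dnf_affine`), which is the shape
`[g (Φ (y₁ ‖ y₂))] = Σ_i [y₁ i][P y₂ i] + [g (w y₂)]`.  With the matrix `M` of `Φ` put `g₁ := g ∘ M` and
`f₁ := f ∘ (M⁻¹)ᵀ` (the transpose-inverse change on the `f`-side): `⟨x, M y⟩ = ⟨Mᵀ x, y⟩` and two reindexings of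
the double sum give `Φ(f₁, g₁) = Φ(f, g)`; a linear substitution does not raise the algebraic degree
(`totalDegree_aeval_le_of_forall_le_one`), so `f₁, g₁` stay cubic.  In the new coordinates
`π y₂ i = g₁(0 ‖ y₂) ⊕ g₁(e_i ‖ y₂)` is the restriction to the flat `{y₁ = 0}` of the derivative of `g₁` in direction
`e_i ‖ 0`, hence quadratic by the hypothesis `hD` (stub D of the line: a derivative loses one degree), and
`h = g₁(0 ‖ ·)` is a restriction of the cubic `g₁`.
-/

set_option linter.dupNamespace false -- D-0017: single-problem summit ⇒ `QuantumAdvantage.QuantumAdvantage` by design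

namespace Summit.QuantumAdvantage.QuantumAdvantage.Theorems.CubicForrelation.NearExactIsExact

open Finset
open scoped Matrix
open Literature.Computability.QuantumComplexity
open Literature.Computability.QuantumComplexity.BuzetChailloux (bxor zeroVec signOf_sq)
open Summit.QuantumAdvantage.QuantumAdvantage.Theorems.ExactPairsMaioranaMcFarland.Negative
  (ind ind_injective ind_bx ite_xor)
open Summit.QuantumAdvantage.QuantumAdvantage.Theorems.CubicForrelation.ExactPairsMaioranaMcFarland
  (dnf_ind_surjective dnf_ind_append dnf_chi_add dnf_signOf_eq_chi dnf_twist_eq_chi dnf_exists_submodule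
    dnf_finrank_eq dnf_exists_linearEquiv dnf_hD_transport dnf_affine)

/-! ### Degree transport under affine-linear substitutions -/

/-- Substituting polynomials of total degree `≤ 1` for the variables does not raise the algebraic degree: if the map
`s : 𝔽₂^k → 𝔽₂^n` is given coordinatewise by polynomials `φ i` of total degree `≤ 1`, then `F ∘ s` has the degree
of `F`. -/
theorem nf_isDegLeFun_subst {n k d : ℕ} (φ : Fin n → MvPolynomial (Fin k) (ZMod 2))
    (hφ : ∀ i, (φ i).totalDegree ≤ 1) (s : (Fin k → Bool) → (Fin n → Bool))
    (hs : ∀ x i, (if s x i then (1 : ZMod 2) else 0) =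
      MvPolynomial.eval (fun j => if x j then (1 : ZMod 2) else 0) (φ i))
    {F : (Fin n → Bool) → Bool} (hF : IsDegLeFun d F) : IsDegLeFun d (fun x => F (s x)) := by
  obtain ⟨p, hp, hpF⟩ := hF
  refine ⟨MvPolynomial.aeval φ p,
    (Literature.Computability.AlgebraicComplexity.totalDegree_aeval_le_of_forall_le_one φ hφ p).trans hp,
    fun x => ?_⟩
  show F (s x) = _
  rw [hpF, polyPhase_apply, polyPhase_apply,
    show MvPolynomial.eval (fun j => if x j then (1 : ZMod 2) else 0) (MvPolynomial.aeval φ p) =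
        MvPolynomial.eval (fun i => MvPolynomial.eval (fun j => if x j then (1 : ZMod 2) else 0) (φ i)) p from
      MvPolynomial.eval₂Hom_bind₁ _ _ _ _,
    show (fun j => if s x j then (1 : ZMod 2) else 0) =
        fun i => MvPolynomial.eval (fun j => if x j then (1 : ZMod 2) else 0) (φ i) from funext (hs x)]

/-- A linear change of variables `x ↦ u (N · ind x)` (`u` a right inverse of `ind`, `N` any matrix over `𝔽₂`)
does not raise the algebraic degree. -/
theorem nf_isDegLeFun_mulVec {n k d : ℕ} (N : Matrix (Fin n) (Fin k) (ZMod 2))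
    (u : (Fin n → ZMod 2) → (Fin n → Bool)) (hu : ∀ v, ind (u v) = v)
    {F : (Fin n → Bool) → Bool} (hF : IsDegLeFun d F) :
    IsDegLeFun d (fun x => F (u (N *ᵥ ind x))) := by
  refine nf_isDegLeFun_subst (fun i => ∑ j, MvPolynomial.C (N i j) * MvPolynomial.X j)
    (fun i => Literature.Computability.AlgebraicComplexity.totalDegree_sum_C_mul_X_le _) _ (fun x i => ?_) hF
  rw [show (if u (N *ᵥ ind x) i then (1 : ZMod 2) else 0) = ind (u (N *ᵥ ind x)) i from rfl, hu]
  simp [Matrix.mulVec, dotProduct, ind]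

/-- Restriction to the flat `{y₁ = 0}` (substitute `0` for the first block of variables) does not raise the
algebraic degree. -/
theorem nf_isDegLeFun_restrict {m k d : ℕ} {F : (Fin (m + k) → Bool) → Bool} (hF : IsDegLeFun d F) :
    IsDegLeFun d (fun y : Fin k → Bool => F (Fin.append zeroVec y)) := by
  refine nf_isDegLeFun_subst
    (Fin.append (fun _ : Fin m => (0 : MvPolynomial (Fin k) (ZMod 2))) MvPolynomial.X)
    (fun i => ?_) _ (fun x i => ?_) hF
  · refine Fin.addCases (fun j => ?_) (fun j => ?_) i
    · rw [Fin.append_left, MvPolynomial.totalDegree_zero]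
      exact Nat.zero_le _
    · rw [Fin.append_right]
      exact (MvPolynomial.totalDegree_X (R := ZMod 2) j).le
  · refine Fin.addCases (fun j => ?_) (fun j => ?_) i
    · rw [Fin.append_left, Fin.append_left, map_zero]
      simp [zeroVec]
    · rw [Fin.append_right, Fin.append_right, MvPolynomial.eval_X]

/-- Blockwise xor of concatenated vectors. -/
theorem nf_bxor_append {m k : ℕ} (a c : Fin m → Bool) (b d : Fin k → Bool) :
    bxor (Fin.append a b) (Fin.append c d) = Fin.append (bxor a c) (bxor b d) := by
  funext i
  refine Fin.addCases (fun j => ?_) (fun j => ?_) i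
  · simp only [bxor, Fin.append_left]
  · simp only [bxor, Fin.append_right]

/-- `|V|² = 2^{m+m}` forces `|V| = 2^m`. -/
theorem nf_card_eq {m c : ℕ} (h : c * c = 2 ^ (m + m)) : c = 2 ^ m := by
  rw [pow_add] at h
  exact Nat.mul_self_inj.1 h

/-! ### The normal form -/

/-- **Maiorana–McFarland normal form of an M-subspace** (Dillon 1974; Carlet 2021, Prop. 54), stub N of the line
`direct-sum-amplification`.  If the cubic `g` on `m + m` bits has an M-subspace `V` (`0 ∈ V`, xor-closed,
`|V|² = 2^{m+m}`, all second differences of `g` along `V` vanish), then after a LINEAR change of coordinates on the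
`g`-side (`g₁ = g ∘ M`, `M` straightening `V` onto the `y₁`-block) and the transpose-inverse change on the `f`-side
(`f₁ = f ∘ (M⁻¹)ᵀ`, which preserves `⟨x, y⟩` and hence the forrelation, and all degrees), the sign of `g₁` has the
shape `(-1)^{g₁(y₁ ‖ y₂)} = (-1)^{⟨y₁, π y₂⟩} (-1)^{h y₂}` with `π` coordinatewise quadratic (a restricted derivative
of the cubic `g₁`, by the hypothesis = stub D) and `h = g₁(0 ‖ ·)` cubic.  No bijectivity of `π` is claimed. -/
theorem stub_mmNormalForm :
    (∀ (n d : ℕ) (e : (Fin n → Bool) → Bool) (t : Fin n → Bool), IsDegLeFun (d + 1) e →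
      IsDegLeFun d (fun x => e x ^^ e (bxor x t))) →
    ∀ (m : ℕ) (f g : (Fin (m + m) → Bool) → Bool), IsDegLeFun 3 f → IsDegLeFun 3 g →
      (∃ V : Finset (Fin (m + m) → Bool), zeroVec ∈ V ∧ (∀ x ∈ V, ∀ y ∈ V, bxor x y ∈ V) ∧
        V.card * V.card = 2 ^ (m + m) ∧
        ∀ u ∈ V, ∀ v ∈ V, ∀ y, (g y ^^ g (bxor y u) ^^ g (bxor y v) ^^ g (bxor y (bxor u v))) = false) →
      ∃ (f₁ g₁ : (Fin (m + m) → Bool) → Bool) (π : (Fin m → Bool) → (Fin m → Bool)) (h : (Fin m → Bool) → Bool),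
        IsDegLeFun 3 f₁ ∧ (∀ i : Fin m, IsDegLeFun 2 (fun y => π y i)) ∧ IsDegLeFun 3 h ∧
        (∀ y₁ y₂ : Fin m → Bool, signOf (g₁ (Fin.append y₁ y₂)) = twist y₁ (π y₂) * signOf (h y₂)) ∧
        forrelation f₁ g₁ = forrelation f g := by
  intro hD m f g hf hg hV
  obtain ⟨V, hV0, hVx, hVc, hD4⟩ := hV
  have hVc' : V.card = 2 ^ m := nf_card_eq hVc
  have hD3 : ∀ a ∈ V, ∀ b ∈ V, ∀ x : Fin (m + m) → Bool,
      (g x ^^ g (bxor x a) ^^ g (bxor x b) ^^ g (bxor (bxor x a) b)) = false := by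
    intro a ha b hb x
    have key := hD4 a ha b hb x
    rwa [show bxor x (bxor a b) = bxor (bxor x a) b from
      funext fun i => (Bool.xor_assoc (x i) (a i) (b i)).symm] at key
  -- the Bool / `ZMod 2` dictionary on `m + m` bits and the pulled-back function `G`
  obtain ⟨ιn, hι⟩ : ∃ ι : (Fin (m + m) → Bool) ≃ (Fin (m + m) → ZMod 2), ∀ x, ι x = ind x :=
    ⟨Equiv.ofBijective ind ⟨ind_injective, dnf_ind_surjective⟩, fun _ => rfl⟩
  have hι' : ∀ v, ind (ιn.symm v) = v := fun v => by rw [← hι, Equiv.apply_symm_apply]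
  have hιs : ∀ x, ιn.symm (ind x) = x := fun x => by rw [← hι, Equiv.symm_apply_apply]
  obtain ⟨G, hG, hGι⟩ : ∃ G : (Fin (m + m) → ZMod 2) → Bool,
      (∀ x, G (ind x) = g x) ∧ ∀ v, g (ιn.symm v) = G v :=
    ⟨fun v => g (ιn.symm v), fun x => by
      show g (ιn.symm (ind x)) = g x
      rw [hιs], fun _ => rfl⟩
  -- the subspace `S` (= `V` read in `ZMod 2`), of dimension `m`, and the straightening automorphism `Φ`
  obtain ⟨S, hSV, hScard⟩ := dnf_exists_submodule V hVx ⟨zeroVec, hV0⟩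
  have hSm : Module.finrank (ZMod 2) S = m := dnf_finrank_eq S (by rw [hScard, hVc'])
  obtain ⟨Φ, bV, w, hbV, hΦ⟩ := dnf_exists_linearEquiv m S hSm
  have hD' := dnf_hD_transport g G hG V S hSV hD3
  -- the matrices of `Φ` and `Φ⁻¹`
  obtain ⟨M, hΦM, hMdef⟩ : ∃ M : Matrix (Fin (m + m)) (Fin (m + m)) (ZMod 2),
      (∀ v, Φ v = M *ᵥ v) ∧ M = LinearMap.toMatrix' Φ.toLinearMap :=
    ⟨_, fun v => (LinearMap.toMatrix'_mulVec Φ.toLinearMap v).symm, rfl⟩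
  obtain ⟨M', hM'M⟩ : ∃ M' : Matrix (Fin (m + m)) (Fin (m + m)) (ZMod 2), M' * M = 1 := by
    refine ⟨LinearMap.toMatrix' Φ.symm.toLinearMap, ?_⟩
    rw [hMdef, ← LinearMap.toMatrix'_comp, LinearEquiv.symm_comp]
    exact LinearMap.toMatrix'_id
  -- the new pair: `g₁ = g ∘ M`, `f₁ = f ∘ M'ᵀ`
  obtain ⟨g₁, hg₁⟩ : ∃ g₁ : (Fin (m + m) → Bool) → Bool, ∀ y, g₁ y = g (ιn.symm (M *ᵥ ind y)) :=
    ⟨_, fun _ => rfl⟩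
  obtain ⟨f₁, hf₁⟩ : ∃ f₁ : (Fin (m + m) → Bool) → Bool, ∀ x, f₁ x = f (ιn.symm (M'ᵀ *ᵥ ind x)) :=
    ⟨_, fun _ => rfl⟩
  have hg₁deg : IsDegLeFun 3 g₁ := by
    rw [show g₁ = fun y => g (ιn.symm (M *ᵥ ind y)) from funext hg₁]
    exact nf_isDegLeFun_mulVec M ιn.symm hι' hg
  have hg₁G : ∀ y₁ y₂ : Fin m → Bool, g₁ (Fin.append y₁ y₂) = G (Φ (Fin.append (ind y₁) (ind y₂))) := by
    intro y₁ y₂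
    rw [hg₁, hGι, ← hΦM, dnf_ind_append]
  -- the Maiorana–McFarland data: `P y″ i = G(w ⊕ v_i) ⊕ G(w)`, `w = w(y″)`, and the shape `hMM`
  obtain ⟨P, hP⟩ : ∃ P : (Fin m → Bool) → (Fin m → Bool),
      ∀ y'' i, P y'' i = (G (w (ind y'') + bV i) ^^ G (w (ind y''))) := ⟨_, fun _ _ => rfl⟩
  have hpt : ∀ y' y'' : Fin m → Bool, Φ (Fin.append (ind y') (ind y'')) =
      w (ind y'') + ∑ i ∈ Finset.univ.filter (fun i => y' i = true), bV i := by
    intro y' y''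
    rw [hΦ, Finset.sum_filter]
    congr 1
    refine Finset.sum_congr rfl fun i _ => ?_
    simp only [ind, ite_zero_smul, one_smul]
  have hMM : ∀ y' y'' : Fin m → Bool,
      (if G (Φ (Fin.append (ind y') (ind y''))) then (1 : ZMod 2) else 0) =
        (∑ i, (if y' i then (1 : ZMod 2) else 0) * (if P y'' i then (1 : ZMod 2) else 0)) +
          (if G (w (ind y'')) then (1 : ZMod 2) else 0) := by
    intro y' y''
    have key := dnf_affine S (fun v => if G v then (1 : ZMod 2) else 0) hD' (w (ind y'')) bV hbV
      (Finset.univ.filter fun i => y' i = true)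
    beta_reduce at key
    rw [hpt, key, add_comm (if G (w (ind y'')) then (1 : ZMod 2) else 0), Finset.sum_filter]
    congr 1
    refine Finset.sum_congr rfl fun i _ => ?_
    rw [boole_mul, hP, ite_xor]
  -- values of `g₁` on the flat `{y₁ = 0}` and on its translates by the unit vectors `e_i ‖ 0`
  have hflat0 : ∀ y₂ : Fin m → Bool, g₁ (Fin.append zeroVec y₂) = G (w (ind y₂)) := by
    intro y₂
    have h0 : (∑ i, ind (zeroVec : Fin m → Bool) i • bV i) = 0 := by
      simp [ind, BuzetChailloux.zeroVec]
    rw [hg₁G, hΦ, h0, add_zero]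
  have hflat1 : ∀ (y₂ : Fin m → Bool) (i : Fin m),
      g₁ (Fin.append (fun j => decide (j = i)) y₂) = G (w (ind y₂) + bV i) := by
    intro y₂ i
    have h1 : (∑ j, ind (fun j : Fin m => decide (j = i)) j • bV j) = bV i := by
      simp [ind, ite_smul, Finset.sum_ite_eq']
    rw [hg₁G, hΦ, h1]
  -- `π` and `h` in the new coordinates
  obtain ⟨π, hπ⟩ : ∃ π : (Fin m → Bool) → (Fin m → Bool), ∀ y₂ i,
      π y₂ i = (g₁ (Fin.append zeroVec y₂) ^^ g₁ (Fin.append (fun j => decide (j = i)) y₂)) :=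
    ⟨_, fun _ _ => rfl⟩
  obtain ⟨h, hh⟩ : ∃ h : (Fin m → Bool) → Bool, ∀ y₂, h y₂ = g₁ (Fin.append zeroVec y₂) := ⟨_, fun _ => rfl⟩
  have hπP : ∀ y₂, π y₂ = P y₂ := fun y₂ => funext fun i => by
    rw [hπ, hP, hflat0, hflat1, Bool.xor_comm]
  refine ⟨f₁, g₁, π, h, ?_, fun i => ?_, ?_, fun y₁ y₂ => ?_, ?_⟩
  · -- `f₁` is cubic: a linear substitution in the cubic `f`
    rw [show f₁ = fun x => f (ιn.symm (M'ᵀ *ᵥ ind x)) from funext hf₁]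
    exact nf_isDegLeFun_mulVec M'ᵀ ιn.symm hι' hf
  · -- `π · i` is quadratic: the derivative of the cubic `g₁` in direction `e_i ‖ 0`, restricted to `{y₁ = 0}`
    have key := nf_isDegLeFun_restrict (m := m)
      (hD (m + m) 2 g₁ (Fin.append (fun j => decide (j = i)) zeroVec) hg₁deg)
    rw [show (fun y => π y i) = fun y => (g₁ (Fin.append zeroVec y) ^^
        g₁ (bxor (Fin.append zeroVec y) (Fin.append (fun j => decide (j = i)) zeroVec))) from
      funext fun y => by
        rw [hπ, nf_bxor_append, BuzetChailloux.zeroVec_bxor, BuzetChailloux.bxor_zeroVec]]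
    exact key
  · -- `h` is cubic: the restriction of the cubic `g₁` to `{y₁ = 0}`
    rw [show h = fun y₂ => g₁ (Fin.append zeroVec y₂) from funext hh]
    exact nf_isDegLeFun_restrict hg₁deg
  · -- the sign shape, from `hMM`
    rw [hh, hflat0, hπP, hg₁G, dnf_signOf_eq_chi (G (Φ (Fin.append (ind y₁) (ind y₂)))), hMM, dnf_chi_add,
      dnf_signOf_eq_chi (G (w (ind y₂))), dnf_twist_eq_chi]
    rfl
  · -- the forrelation is unchanged: `⟨x, M y⟩ = ⟨Mᵀ x, y⟩` and two reindexings
    unfold forrelation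
    congr 1
    obtain ⟨e, he⟩ : ∃ e : (Fin (m + m) → Bool) ≃ (Fin (m + m) → Bool), ∀ y, e y = ιn.symm (M *ᵥ ind y) :=
      ⟨ιn.trans (Φ.toEquiv.trans ιn.symm), fun y => by
        show ιn.symm (Φ (ιn y)) = _
        rw [hι, hΦM]⟩
    have hge : ∀ y, g (e y) = g₁ y := fun y => by rw [he, hg₁]
    have hεε : ∀ x, ιn.symm (Mᵀ *ᵥ ind (ιn.symm (M'ᵀ *ᵥ ind x))) = x := fun x => by
      rw [hι', Matrix.mulVec_mulVec, ← Matrix.transpose_mul, hM'M, Matrix.transpose_one, Matrix.one_mulVec, hιs]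
    have hbij : Function.Bijective (fun x => ιn.symm (M'ᵀ *ᵥ ind x)) :=
      Finite.injective_iff_bijective.1
        (Function.LeftInverse.injective (g := fun x => ιn.symm (Mᵀ *ᵥ ind x)) hεε)
    have htwist : ∀ x y, twist x (e y) = twist (ιn.symm (Mᵀ *ᵥ ind x)) y := fun x y => by
      rw [dnf_twist_eq_chi, dnf_twist_eq_chi, he, hι', hι', Matrix.dotProduct_mulVec, ← Matrix.mulVec_transpose]
    symm
    calc ∑ x, ∑ y, signOf (f x) * twist x y * signOf (g y)
        = ∑ x, ∑ y, signOf (f x) * twist x (e y) * signOf (g (e y)) :=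
          Finset.sum_congr rfl fun x _ =>
            (Equiv.sum_comp e (fun y => signOf (f x) * twist x y * signOf (g y))).symm
      _ = ∑ y, ∑ x, signOf (f x) * twist (ιn.symm (Mᵀ *ᵥ ind x)) y * signOf (g₁ y) := by
          rw [Finset.sum_comm]
          refine Finset.sum_congr rfl fun y _ => Finset.sum_congr rfl fun x _ => ?_
          rw [htwist, hge]
      _ = ∑ y, ∑ x, signOf (f₁ x) * twist x y * signOf (g₁ y) := by
          refine Finset.sum_congr rfl fun y _ => ?_
          rw [← hbij.sum_comp (fun x => signOf (f x) * twist (ιn.symm (Mᵀ *ᵥ ind x)) y * signOf (g₁ y))]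
          refine Finset.sum_congr rfl fun x _ => ?_
          simp only [hεε, hf₁]
      _ = ∑ x, ∑ y, signOf (f₁ x) * twist x y * signOf (g₁ y) := Finset.sum_comm

end Summit.QuantumAdvantage.QuantumAdvantage.Theorems.CubicForrelation.NearExactIsExact
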